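import Summits.AtomisticToContinuum.Crystallization.Theorems.OverbindingBudgetAffineRunCutA

/-!
# NODE g78 «RunCut» — PART B: §3 the seams (PROVED) and §4 the record through the RunCut (BY NAME on 77T).

See PART A (`…OverbindingBudgetAffineRunCutA`) for the module documentation of the node; this part continues the same namespace.
-/

namespace Summit.AtomisticToContinuum.Crystallization.Theorems.OverbindingBudgetAffineRunCut

open scoped BigOperators Classical
open Literature.MathematicalPhysics.StatisticalMechanics
open Literature.Geometry.DiscreteGeometry (IsChargeFree nearestDist nearestDist_nonneg nearestDist_le_dist fccTwoShellPattern hcpTwoShellPattern)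
open Summit.AtomisticToContinuum.Crystallization.Theorems.OverbindingBudgetMisfitRegistration (Framed Reg DeepReg)
open Summit.AtomisticToContinuum.Crystallization.Theorems.OverbindingBudgetMisfitWindowStatements (InWindow offCount)
open Summit.AtomisticToContinuum.Crystallization.Theorems.OverbindingBudgetMisfitCensusStatements (card_le_of_cube)
open Summit.AtomisticToContinuum.Crystallization.Theorems.OverbindingBudgetBalancedCensusStatements
open Summit.AtomisticToContinuum.Crystallization.Theorems.OverbindingBudgetAffineLadder
open Summit.AtomisticToContinuum.Crystallization.Theorems.OverbindingBudgetAffineMesoCut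
open Summit.AtomisticToContinuum.Crystallization.Theorems.OverbindingBudgetAffinePhaseCut
open Summit.AtomisticToContinuum.Crystallization.Theorems.OverbindingBudgetAffineCushionCut
open Summit.AtomisticToContinuum.Crystallization.Theorems.OverbindingBudgetAffineTwinCut

variable {N : ℕ}

local notation "E3" => EuclideanSpace ℝ (Fin 3)

/-! ## §3  THE SEAMS (PROVED).  HI ⇒ every piece; RunInterior ∧ FaultZone ⇒ HI; RigidRun ∧ CompressedRun ∧ WildRun ⇒ RunInterior;
SW ⇒ RX (floor); RX ∧ CompressedRun ∧ WildRun ⇒ RigidRun (glue) -/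

/-- **HI_W ⇒ RunInterior_W** (subset priced, same rebate). [this file] -/
theorem balancedRunInteriorGapW_of_interfaceW {ρ ε g r rh σ₁ σ₂ : ℝ} (h : BalancedInterfaceCubicGapW ρ ε g r σ₁ σ₂) :
    BalancedRunInteriorGapW ρ ε g r rh σ₁ σ₂ :=
  balancedRunInteriorGapW_iff_censusW.2 <|
    censusW_mono (fun y => runInteriorCount_le_interfaceCubicCount y) (fun _ => le_rfl) (balancedInterfaceCubicGapW_iff_censusW.1 h)

/-- **HI_W ⇒ FaultZone_W**. [this file] -/
theorem balancedFaultZoneGapW_of_interfaceW {ρ ε g r rh σ₁ σ₂ : ℝ} (h : BalancedInterfaceCubicGapW ρ ε g r σ₁ σ₂) :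
    BalancedFaultZoneGapW ρ ε g r rh σ₁ σ₂ :=
  balancedFaultZoneGapW_iff_censusW.2 <|
    censusW_mono (fun y => faultZoneCount_le_interfaceCubicCount y) (fun _ => le_rfl) (balancedInterfaceCubicGapW_iff_censusW.1 h)

/-- **RunInterior_W ⇒ RigidRun_W**. [this file] -/
theorem balancedRigidRunGapW_of_runInteriorW {ρ ρ₁ η θ₀ s₁ ε g r rh σ₁ σ₂ : ℝ} (h : BalancedRunInteriorGapW ρ ε g r rh σ₁ σ₂) :
    BalancedRigidRunGapW ρ ρ₁ η θ₀ s₁ ε g r rh σ₁ σ₂ :=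
  balancedRigidRunGapW_iff_censusW.2 <|
    censusW_mono (fun y => rigidRunCount_le_runInteriorCount y) (fun _ => le_rfl) (balancedRunInteriorGapW_iff_censusW.1 h)

/-- **RunInterior_W ⇒ CompressedRun_W**. [this file] -/
theorem balancedCompressedRunGapW_of_runInteriorW {ρ ρ₁ η θ₀ s₁ ε g r rh σ₁ σ₂ : ℝ} (h : BalancedRunInteriorGapW ρ ε g r rh σ₁ σ₂) :
    BalancedCompressedRunGapW ρ ρ₁ η θ₀ s₁ ε g r rh σ₁ σ₂ :=
  balancedCompressedRunGapW_iff_censusW.2 <|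
    censusW_mono (fun y => compressedRunCount_le_runInteriorCount y) (fun _ => le_rfl) (balancedRunInteriorGapW_iff_censusW.1 h)

/-- **RunInterior_W ⇒ WildRun_W**. [this file] -/
theorem balancedWildRunGapW_of_runInteriorW {ρ ρ₁ η θ₀ ε g r rh σ₁ σ₂ : ℝ} (h : BalancedRunInteriorGapW ρ ε g r rh σ₁ σ₂) :
    BalancedWildRunGapW ρ ρ₁ η θ₀ ε g r rh σ₁ σ₂ :=
  balancedWildRunGapW_iff_censusW.2 <|
    censusW_mono (fun y => wildRunCount_le_runInteriorCount y) (fun _ => le_rfl) (balancedRunInteriorGapW_iff_censusW.1 h)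

/-- **RigidRun_W ⇒ RigidRunExchange_W** (same count, larger rebate) — hence HI_W ⇒ RX_W. [this file] -/
theorem balancedRigidRunExchangeGapW_of_rigidRunW {ρ ρ₁ η θ₀ s₁ ε g r rh σ₁ σ₂ : ℝ} (h : BalancedRigidRunGapW ρ ρ₁ η θ₀ s₁ ε g r rh σ₁ σ₂) :
    BalancedRigidRunExchangeGapW ρ ρ₁ η θ₀ s₁ ε g r rh σ₁ σ₂ :=
  balancedRigidRunExchangeGapW_iff_censusW.2 <|
    censusW_mono (fun _ => le_rfl) (fun _ => Nat.le_add_right _ _) (balancedRigidRunGapW_iff_censusW.1 h)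

/-- **HI_W ⇒ RigidRunExchange_W**. [this file] -/
theorem balancedRigidRunExchangeGapW_of_interfaceW {ρ ρ₁ η θ₀ s₁ ε g r rh σ₁ σ₂ : ℝ} (h : BalancedInterfaceCubicGapW ρ ε g r σ₁ σ₂) :
    BalancedRigidRunExchangeGapW ρ ρ₁ η θ₀ s₁ ε g r rh σ₁ σ₂ :=
  balancedRigidRunExchangeGapW_of_rigidRunW (balancedRigidRunGapW_of_runInteriorW (balancedRunInteriorGapW_of_interfaceW h))

/-- **RunInterior_W ∧ FaultZone_W ⇒ HI_W** (excluded middle on the position in the word, glued once). [this file] -/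
theorem balancedInterfaceCubicGapW_of_run_fault {ρ ε g r rh σ₁ σ₂ : ℝ}
    (hA : BalancedRunInteriorGapW ρ ε g r rh σ₁ σ₂) (hZ : BalancedFaultZoneGapW ρ ε g r rh σ₁ σ₂) : BalancedInterfaceCubicGapW ρ ε g r σ₁ σ₂ :=
  balancedInterfaceCubicGapW_iff_censusW.2 <|
    censusW_glue (fun y => interfaceCubicCount_le_runInterior_add_faultZone y) (fun _ => Nat.le_add_right _ _)
      (balancedRunInteriorGapW_iff_censusW.1 hA) (balancedFaultZoneGapW_iff_censusW.1 hZ)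

/-- **RigidRun_W ∧ CompressedRun_W ∧ WildRun_W ⇒ RunInterior_W** (excluded middle on the mechanical state, glued twice). [this file] -/
theorem balancedRunInteriorGapW_of_rigid_compressed_wild {ρ ρ₁ η θ₀ s₁ ε g r rh σ₁ σ₂ : ℝ}
    (hR : BalancedRigidRunGapW ρ ρ₁ η θ₀ s₁ ε g r rh σ₁ σ₂) (hO : BalancedCompressedRunGapW ρ ρ₁ η θ₀ s₁ ε g r rh σ₁ σ₂)
    (hX : BalancedWildRunGapW ρ ρ₁ η θ₀ ε g r rh σ₁ σ₂) : BalancedRunInteriorGapW ρ ε g r rh σ₁ σ₂ := by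
  have hOX : CensusW (fun y => compressedRunCount ρ ρ₁ η θ₀ s₁ ε g r rh y + wildRunCount ρ ρ₁ η θ₀ ε g r rh y)
      (fun y => notDeepCount ρ ε g y) σ₁ σ₂ :=
    censusW_glue (fun _ => le_rfl) (fun _ => Nat.le_add_right _ _)
      (balancedCompressedRunGapW_iff_censusW.1 hO) (balancedWildRunGapW_iff_censusW.1 hX)
  exact balancedRunInteriorGapW_iff_censusW.2 <|
    censusW_glue (fun y => (runInteriorCount_le_rigid_add_compressed_add_wild y).trans (Nat.add_assoc _ _ _).le)
      (fun _ => Nat.le_add_right _ _) (balancedRigidRunGapW_iff_censusW.1 hR) hOX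

/-- **THE FLOOR STEP: SW_W ⇒ RigidRunExchange_W.**  The free bulk floor `N e⋆ ≤ 𝓔(y′)` (`floor_le` BY NAME) is spent on the competitor; the result is the
census inequality for `#rigidRun` with the enlarged rebate and no gain term (gains are subtracted with a non-negative constant). [this file] -/
theorem balancedRigidRunExchangeGapW_of_stackSwapGainW {ρ ρ₁ η θ₀ s₁ ε g r rh σ₁ σ₂ : ℝ} (hT : StackSwapGainW ρ ρ₁ η θ₀ s₁ ε g r rh σ₁ σ₂) :
    BalancedRigidRunExchangeGapW ρ ρ₁ η θ₀ s₁ ε g r rh σ₁ σ₂ := by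
  obtain ⟨c, C, hc, h⟩ := hT
  refine ⟨c, max C 0, hc, fun N y hy => ⟨e0, norm_e0, ?_⟩⟩
  obtain ⟨y', hy', -, H⟩ := h N y hy
  have hfl := floor_le hy'
  have hCle : C ≤ max C 0 := le_max_left _ _
  have hC0 : 0 ≤ max C 0 := le_max_right _ _
  have nX : (0 : ℝ) ≤ ((compressedRunCount ρ ρ₁ η θ₀ s₁ ε g r rh y + wildRunCount ρ ρ₁ η θ₀ ε g r rh y : ℕ) : ℝ) := Nat.cast_nonneg _
  have nD : (0 : ℝ) ≤ notDeepCount ρ ε g y := Nat.cast_nonneg _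
  have nO : (0 : ℝ) ≤ offCount σ₁ σ₂ y := Nat.cast_nonneg _
  have nS : (0 : ℝ) ≤ (N : ℝ) ^ (2 / 3 : ℝ) := Real.rpow_nonneg (Nat.cast_nonneg _) _
  have g2 : 0 ≤ dilGain y + shGain e0 y := add_nonneg (dilGain_nonneg y) (shGain_nonneg _ y)
  have m1 : C * ((compressedRunCount ρ ρ₁ η θ₀ s₁ ε g r rh y + wildRunCount ρ ρ₁ η θ₀ ε g r rh y : ℕ) : ℝ)
      ≤ max C 0 * ((compressedRunCount ρ ρ₁ η θ₀ s₁ ε g r rh y + wildRunCount ρ ρ₁ η θ₀ ε g r rh y : ℕ) : ℝ) :=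
    mul_le_mul_of_nonneg_right hCle nX
  have m2 : C * (notDeepCount ρ ε g y : ℝ) ≤ max C 0 * (notDeepCount ρ ε g y : ℝ) := mul_le_mul_of_nonneg_right hCle nD
  have m3 : C * (offCount σ₁ σ₂ y : ℝ) ≤ max C 0 * (offCount σ₁ σ₂ y : ℝ) := mul_le_mul_of_nonneg_right hCle nO
  have m4 : C * (N : ℝ) ^ (2 / 3 : ℝ) ≤ max C 0 * (N : ℝ) ^ (2 / 3 : ℝ) := mul_le_mul_of_nonneg_right hCle nS
  have m5 : 0 ≤ max C 0 * (dilGain y + shGain e0 y) := mul_nonneg hC0 g2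
  push_cast at H m1 ⊢
  nlinarith [H, hfl, m1, m2, m3, m4, m5]

/-- **THE GLUE STEP: RigidRunExchange_W ∧ CompressedRun_W ∧ WildRun_W ⇒ RigidRun_W** — the exchange currency `#compressedRun + #wildRun` is priced by
two pieces WEAKER THAN HI; one glued convex combination buys it back (`censusW_glue` with `D₁ = D + B`). [this file] -/
theorem balancedRigidRunGapW_of_exchange_compressed_wild {ρ ρ₁ η θ₀ s₁ ε g r rh σ₁ σ₂ : ℝ}
    (hE : BalancedRigidRunExchangeGapW ρ ρ₁ η θ₀ s₁ ε g r rh σ₁ σ₂) (hO : BalancedCompressedRunGapW ρ ρ₁ η θ₀ s₁ ε g r rh σ₁ σ₂)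
    (hX : BalancedWildRunGapW ρ ρ₁ η θ₀ ε g r rh σ₁ σ₂) : BalancedRigidRunGapW ρ ρ₁ η θ₀ s₁ ε g r rh σ₁ σ₂ := by
  have hOX : CensusW (fun y => compressedRunCount ρ ρ₁ η θ₀ s₁ ε g r rh y + wildRunCount ρ ρ₁ η θ₀ ε g r rh y)
      (fun y => notDeepCount ρ ε g y) σ₁ σ₂ :=
    censusW_glue (fun _ => le_rfl) (fun _ => Nat.le_add_right _ _)
      (balancedCompressedRunGapW_iff_censusW.1 hO) (balancedWildRunGapW_iff_censusW.1 hX)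
  exact balancedRigidRunGapW_iff_censusW.2 <|
    censusW_glue (R := fun y => rigidRunCount ρ ρ₁ η θ₀ s₁ ε g r rh y) (fun _ => Nat.le_add_right _ _) (fun _ => le_rfl)
      (balancedRigidRunExchangeGapW_iff_censusW.1 hE) hOX

/-- **THE COMPETITOR SEAM (one window): SW_W ∧ CompressedRun_W ∧ WildRun_W ∧ FaultZone_W ⇒ HI_W.** [this file] -/
theorem balancedInterfaceCubicGapW_of_stackSwap {ρ ρ₁ η θ₀ s₁ ε g r rh σ₁ σ₂ : ℝ}
    (hT : StackSwapGainW ρ ρ₁ η θ₀ s₁ ε g r rh σ₁ σ₂) (hO : BalancedCompressedRunGapW ρ ρ₁ η θ₀ s₁ ε g r rh σ₁ σ₂)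
    (hX : BalancedWildRunGapW ρ ρ₁ η θ₀ ε g r rh σ₁ σ₂) (hZ : BalancedFaultZoneGapW ρ ε g r rh σ₁ σ₂) :
    BalancedInterfaceCubicGapW ρ ε g r σ₁ σ₂ :=
  balancedInterfaceCubicGapW_of_run_fault
    (balancedRunInteriorGapW_of_rigid_compressed_wild
      (balancedRigidRunGapW_of_exchange_compressed_wild (balancedRigidRunExchangeGapW_of_stackSwapGainW hT) hO hX) hO hX) hZ

/-! ### Tame forms and the literals of record -/

/-- **HI ⟺ RunInterior ∧ FaultZone** (LOSSLESS position-in-word cut; both pieces weaker). [this file] -/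
theorem interfaceDominance_iff_run_fault : InterfaceDominance ↔ RunInterior ∧ FaultZone :=
  ⟨fun h => ⟨fun δ hδ hδ2 => balancedRunInteriorGapW_of_interfaceW (h δ hδ hδ2),
      fun δ hδ hδ2 => balancedFaultZoneGapW_of_interfaceW (h δ hδ hδ2)⟩,
    fun h δ hδ hδ2 => balancedInterfaceCubicGapW_of_run_fault (h.1 δ hδ hδ2) (h.2 δ hδ hδ2)⟩

/-- **RunInterior ⟺ RigidRun ∧ CompressedRun ∧ WildRun** (LOSSLESS mechanical trichotomy; all three weaker). [this file] -/
theorem runInterior_iff_mech : RunInterior ↔ RigidRun ∧ CompressedRun ∧ WildRun :=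
  ⟨fun h => ⟨fun δ hδ hδ2 => balancedRigidRunGapW_of_runInteriorW (h δ hδ hδ2),
      fun δ hδ hδ2 => balancedCompressedRunGapW_of_runInteriorW (h δ hδ hδ2),
      fun δ hδ hδ2 => balancedWildRunGapW_of_runInteriorW (h δ hδ hδ2)⟩,
    fun h δ hδ hδ2 => balancedRunInteriorGapW_of_rigid_compressed_wild (h.1 δ hδ hδ2) (h.2.1 δ hδ hδ2) (h.2.2 δ hδ hδ2)⟩

/-- **HI ⇒ RigidRunExchange** (RX is weaker than HI). [this file] -/
theorem rigidRunExchange_of_interfaceDominance (h : InterfaceDominance) : RigidRunExchange :=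
  fun δ hδ hδ2 => balancedRigidRunExchangeGapW_of_interfaceW (h δ hδ hδ2)

/-- **SW ⇒ RigidRunExchange** (the competitor suffices for the surgery leaf). [this file] -/
theorem rigidRunExchange_of_stackSwapGain (h : StackSwapGain) : RigidRunExchange :=
  fun δ hδ hδ2 => balancedRigidRunExchangeGapW_of_stackSwapGainW (h δ hδ hδ2)

/-- **RigidRunExchange ∧ CompressedRun ∧ WildRun ⇒ RigidRun**. [this file] -/
theorem rigidRun_of_exchange (hE : RigidRunExchange) (hO : CompressedRun) (hX : WildRun) : RigidRun :=
  fun δ hδ hδ2 => balancedRigidRunGapW_of_exchange_compressed_wild (hE δ hδ hδ2) (hO δ hδ hδ2) (hX δ hδ hδ2)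

/-- **HI ⟺ RigidRunExchange ∧ CompressedRun ∧ WildRun ∧ FaultZone** — the LOSSLESS four-leaf form of the node: one leaf (RX) carries a competitor
sufficient condition, one (RO) is sitewise-attackable, two (RW, FZ) are the honest residual. [this file] -/
theorem interfaceDominance_iff_fourLeaves : InterfaceDominance ↔ RigidRunExchange ∧ CompressedRun ∧ WildRun ∧ FaultZone := by
  constructor
  · intro h
    have hA : RunInterior := (interfaceDominance_iff_run_fault.1 h).1
    exact ⟨rigidRunExchange_of_interfaceDominance h, (runInterior_iff_mech.1 hA).2.1, (runInterior_iff_mech.1 hA).2.2,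
      (interfaceDominance_iff_run_fault.1 h).2⟩
  · rintro ⟨hE, hO, hX, hZ⟩
    exact interfaceDominance_iff_run_fault.2 ⟨runInterior_iff_mech.2 ⟨rigidRun_of_exchange hE hO hX, hO, hX⟩, hZ⟩

/-- **THE COMPETITOR SEAM OF RECORD: StackSwapGain ∧ CompressedRun ∧ WildRun ∧ FaultZone ⇒ InterfaceDominance.** [this file] -/
theorem interfaceDominance_of_runCut (hT : StackSwapGain) (hO : CompressedRun) (hX : WildRun) (hZ : FaultZone) : InterfaceDominance :=
  interfaceDominance_iff_fourLeaves.2 ⟨rigidRunExchange_of_stackSwapGain hT, hO, hX, hZ⟩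

/-! ## §4  THE RECORD THROUGH THE RunCut (BY NAME on 77T's record theorems) -/

/-- **MR of record from `QH ∧ RoughCubic ∧ StackSwapGain ∧ CompressedRun ∧ WildRun ∧ FaultZone`** (77T's `affMid_record_of_roughCut` with HI from the
RunCut). [this file] -/
theorem affMid_record_of_runCut (hQH : TameBalancedHexRoughGap 64 12 (1 / 10 ^ 5) (1 / 25) (3 / 50) (1 / 450) 12) (hQ : RoughCubic)
    (hT : StackSwapGain) (hO : CompressedRun) (hX : WildRun) (hZ : FaultZone) :
    TameBalancedAffMidGap 64 12 (1 / 10 ^ 5) (1 / 25) (3 / 50) (1 / 450) :=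
  affMid_record_of_roughCut hQH hQ (interfaceDominance_of_runCut hT hO hX hZ)

/-- MR of record from the LOSSLESS leaves `QH ∧ RoughCubic ∧ RigidRunExchange ∧ CompressedRun ∧ WildRun ∧ FaultZone`. [this file] -/
theorem affMid_record_of_fourLeaves (hQH : TameBalancedHexRoughGap 64 12 (1 / 10 ^ 5) (1 / 25) (3 / 50) (1 / 450) 12) (hQ : RoughCubic)
    (hE : RigidRunExchange) (hO : CompressedRun) (hX : WildRun) (hZ : FaultZone) :
    TameBalancedAffMidGap 64 12 (1 / 10 ^ 5) (1 / 25) (3 / 50) (1 / 450) :=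
  affMid_record_of_roughCut hQH hQ (interfaceDominance_iff_fourLeaves.2 ⟨hE, hO, hX, hZ⟩)

/-- **Slot-3 cone of record through the RunCut**: 77T's `tbdsg_of_roughCut_record` with HI supplied by `StackSwapGain ∧ CompressedRun ∧ WildRun ∧ FaultZone`.
[this file] -/
theorem tbdsg_of_runCut_record
    (hQH : TameBalancedHexRoughGap 64 12 (1 / 10 ^ 5) (1 / 25) (3 / 50) (1 / 450) 12) (hQ : RoughCubic)
    (hT : StackSwapGain) (hO : CompressedRun) (hX : WildRun) (hZ : FaultZone)
    (hK : ∃ μ₁ μR : ℝ, 0 < μ₁ ∧ 0 < μR ∧ OverbindingBudgetAffineNearCluster.PureMarginStabilityAt (3 / 2000) μ₁ μR 4)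
    (hA : AffineChartStraightening)
    (hE : OverbindingBudgetAffineNearCluster.NearLightSkeletonEquilibrium (3 / 2000) 4 6 (1 / 1000) 12 (1 / 25) (1 / 2000) 4 6 320 12)
    (hC : OverbindingBudgetAffineNearCluster.NearPricedCoreFloor (3 / 2000) 4 6 (1 / 1000) 12 (1 / 25) (1 / 2000) (1 / (4 * 10 ^ 7) / 4) 4 6 12)
    (hS : OverbindingBudgetAffineNearCluster.NearPricedShellFloor (3 / 2000) 4 6 (1 / 1000) 12 (1 / 25) (1 / 2000) (1 / (4 * 10 ^ 7) / 4) 4 6 12)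
    (hV : OverbindingBudgetAffineNearCluster.ForceContentVisible (3 / 2000) 4 6 (1 / 1000) 12 (1 / 25) (1 / 2000) 4 6)
    (hN : OverbindingBudgetAffineNearCluster.NearSecondOrderFloor (3 / 2000) 4 6 (1 / 1000) 12 (1 / 25) (1 / 2000) (1 / (4 * 10 ^ 7)))
    (hFA : OverbindingBudgetAffineLocalisation.FarAggregatePricing 12 (1 / 25) (1 / 2000) (1 / (2 * 10 ^ 7)))
    (hFR : FineNonAffinity 12 (1 / 10 ^ 5) (1 / 25)) :
    TameBalancedDeepScaleGap (122 / 125) 0 4 (3 / 50) (1 / 450) :=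
  tbdsg_of_roughCut_record hQH hQ (interfaceDominance_of_runCut hT hO hX hZ) hK hA hE hC hS hV hN hFA hFR

/-- **RDEF cone of record through the RunCut**: 77T's `rdef_of_ceg_shape_roughCut_record` with HI supplied by the RunCut leaves. [this file] -/
theorem rdef_of_ceg_shape_runCut_record
    (hCEG : Summit.AtomisticToContinuum.Crystallization.Theses.PricedLinkCensus.ChargedEnergyGap)
    (hSh : OverbindingBudgetTwoShellShape.TwoShellShape (1 / 100) (3 / 50) (1 / 450))
    (hQH : TameBalancedHexRoughGap 64 12 (1 / 10 ^ 5) (1 / 25) (3 / 50) (1 / 450) 12) (hQ : RoughCubic)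
    (hT : StackSwapGain) (hO : CompressedRun) (hX : WildRun) (hZ : FaultZone)
    (hK : ∃ μ₁ μR : ℝ, 0 < μ₁ ∧ 0 < μR ∧ OverbindingBudgetAffineNearCluster.PureMarginStabilityAt (3 / 2000) μ₁ μR 4)
    (hA : AffineChartStraightening)
    (hE : OverbindingBudgetAffineNearCluster.NearLightSkeletonEquilibrium (3 / 2000) 4 6 (1 / 1000) 12 (1 / 25) (1 / 2000) 4 6 320 12)
    (hC : OverbindingBudgetAffineNearCluster.NearPricedCoreFloor (3 / 2000) 4 6 (1 / 1000) 12 (1 / 25) (1 / 2000) (1 / (4 * 10 ^ 7) / 4) 4 6 12)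
    (hS : OverbindingBudgetAffineNearCluster.NearPricedShellFloor (3 / 2000) 4 6 (1 / 1000) 12 (1 / 25) (1 / 2000) (1 / (4 * 10 ^ 7) / 4) 4 6 12)
    (hV : OverbindingBudgetAffineNearCluster.ForceContentVisible (3 / 2000) 4 6 (1 / 1000) 12 (1 / 25) (1 / 2000) 4 6)
    (hN : OverbindingBudgetAffineNearCluster.NearSecondOrderFloor (3 / 2000) 4 6 (1 / 1000) 12 (1 / 25) (1 / 2000) (1 / (4 * 10 ^ 7)))
    (hFA : OverbindingBudgetAffineLocalisation.FarAggregatePricing 12 (1 / 25) (1 / 2000) (1 / (2 * 10 ^ 7)))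
    (hFR : FineNonAffinity 12 (1 / 10 ^ 5) (1 / 25))
    (hTT : OverbindingBudgetGradedBareness.CleanlessExcessT) (hR : OverbindingBudgetCoherentCut.CoherentResidual 10) :
    Summit.AtomisticToContinuum.Crystallization.Theses.OverbindingBudget.RobustDefectLimitWindows :=
  rdef_of_ceg_shape_roughCut_record hCEG hSh hQH hQ (interfaceDominance_of_runCut hT hO hX hZ) hK hA hE hC hS hV hN hFA hFR hTT hR

end Summit.AtomisticToContinuum.Crystallization.Theorems.OverbindingBudgetAffineRunCut
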